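import Mathlib
import Summits.Ventures.LatticeQCDFlow.Scaling.GroupTorusHeight
import Summits.Ventures.LatticeQCDFlow.Scaling.GroupSlabMoments
import Summits.Ventures.LatticeQCDFlow.Scaling.GroupSlabEigen
import Summits.Ventures.LatticeQCDFlow.Scaling.SlabChainEigen
import Summits.Ventures.LatticeQCDFlow.Scaling.SlabChainCovariance
import Summits.Ventures.LatticeQCDFlow.Scaling.CrossCutFloorOfLeadingCoeff

/-!
# LatticeQCDFlow / Scaling — (LC) AT EVERY SEPARATION and (U′) AT STRONG COUPLING FOR EVERY `R`,
# FOR A GENERAL COMPACT GAUGE GROUP: the leading tube coefficient `N θ^{4t+1}`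

HONEST FRAMING: exact (Metropolis-corrected) sampling algorithms for lattice gauge theory;
figures of merit are autocorrelation/cost numbers at stated couplings and volumes; no
continuum-physics claim.

Venture `LatticeQCDFlow` (cell pub-lqcd), topic `Scaling`, FANOUT row 30 (lean-1) — OUR WORK, file
8 (the assembly) of the extension of the slab-chain proof of (LC)/(U′) from `U(1)`
(`Scaling/U1CrossCutFloorAllT.lean`) to a general compact, second countable gauge group `G` with a
matrix representation `ρ : G →* M_N(ℂ)` carrying one-link data `OneLink ρ θ`
(`Scaling/GroupLayerHaar.lean`: continuity, `tr ρ(g⁻¹) = conj tr ρ(g)`, `∫ Re tr ρ = 0`,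
`∫ Re tr ρ(g) ρ(g)_{ab} dg = θ δ_{ab}`).  The torus plaquette system `torusSystem ρ (L+1)` is read
by heights along the axis `a` as the slab chain `gChain ρ d L a` (`Scaling/GroupTorusHeight.lean`);
it meets the hypotheses of THE SLAB-CHAIN THEOREM `SlabChain.cov_tilt_jetEq` with `g = 4`
(`gChain_bounds`, `gChain_moments`: `Scaling/GroupSlabMoments.lean` for `m ≤ 3`,
`Scaling/GroupSlabCost.lean` for the centred order-four kernel `rho4G`), the plaquette observable
`xObsG` is an eigenfunction of `rho4G` with eigenvalue `θ⁴` (`Scaling/GroupSlabEigen.lean`) and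
`E[xObsG²] = N θ` (`Scaling/GroupPlaquetteLayer.lean`), so `Scaling/SlabChainEigen.lean` gives the
leading coefficient `b = N θ^{4t+1}`.  Hence
* **`torusTruncC_leadingCoeff`** — (LC) at EVERY separation `t ≥ 1` for `(G, ρ)`: for every torus
  side `L+1` with `L ≥ max 3 (2t)`, every `d`, `i < j`, `a ∉ {i, j}`:
  `torusTruncC ρ (L+1) P P (t·e_a) β − N θ^{4t+1} β^{4t} = O(β^{4t+1})` at `β = 0`;
* **`crossCutCorrelatorFloor_of_oneLink`**, **`crossCutCorrelatorFloorR_of_oneLink`** — for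
  `N ≥ 1` and EVERY `R` there is ONE `β₀ > 0` such that `Conjectures.CrossCutCorrelatorFloor d N G
  ρ β R i j a` (and `…FloorR`) holds for every real `β ≠ 0` with `|β| ≤ β₀` (`θ > 0`,
  `GroupLayer.theta_pos`; item 121's bridge `crossCutCorrelatorFloor_of_leadingCoeff`).
Instances: `U(1)` (`N = 1`, `θ = 1/2`: `b = 2^{-(4t+1)}`, gen-9's number), `SU(N)`, `N ≥ 3`
(`θ = 1/(2N)`: `b = 2^{-(4t+1)} N^{-4t}` [cite: MontvayMunster1994, §3.6.2 (3.437)]), `SU(2)`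
(`θ = 1/2`: `b = 2^{-4t}`) — the one-link data for `SU(N)` is the sequel file.  Elementary given the
imports; nothing is cited as a fact; `def`s `HCfgG`, `gMoment`, `obsXG`, `obsXYG`; no `sorry`.
-/

noncomputable section

open MeasureTheory Filter Topology Asymptotics Finset
open scoped Nat
open Literature.MathematicalPhysics.QuantumFieldTheory
open Literature.MathematicalPhysics.QuantumLattice (plaquetteObs configShift toTorusObservable
  toTorusObservable_apply)
open Literature.Probability.LatticeModels (Torus.proj Torus.proj_apply)
open Summit.Ventures.LatticeQCDFlow.Theory2.Tilted
open Summit.Ventures.LatticeQCDFlow.Theory2.Lattice.U1Layer (LSite LEdge zsite usite pedge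
  update_zero_eq_neg_single)

namespace Summit.Ventures.LatticeQCDFlow.Theory2.GroupLayer

variable {G : Type} [Group G] [TopologicalSpace G] [IsTopologicalGroup G] [CompactSpace G]
  [MeasurableSpace G] [BorelSpace G] [SecondCountableTopology G]
variable {d n N : ℕ} {a i j : Fin d} {ρ : G →* Matrix (Fin N) (Fin N) ℂ} {θ : ℝ}

/-! ## 1. The slab chain of `ρ` meets the hypotheses of the slab-chain theorem -/

/-- The height configurations: layer variables and vertical variables by height. [folklore] -/
abbrev HCfgG (G : Type) (d n : ℕ) (a : Fin d) : Type :=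
  (Fin (n + 1) → LEdge d (n + 1) a → G) × (Fin (n + 1) → LSite d (n + 1) a → G)

omit [CompactSpace G] [MeasurableSpace G] [BorelSpace G] [SecondCountableTopology G] in
/-- A horizontal plaquette holonomy is continuous in the layer variables. [folklore] -/
theorem continuous_hplaqG (y : LSite d (n + 1) a) {k l : Fin d} (hk : k ≠ a) (hl : l ≠ a) :
    Continuous fun e : LEdge d (n + 1) a → G => hplaqG e y k l hk hl := by
  unfold hplaqG; fun_prop

omit [CompactSpace G] [MeasurableSpace G] [BorelSpace G] [SecondCountableTopology G] in
/-- The in-layer cost is continuous. [folklore] -/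
theorem continuous_layerCostG (hρ : Continuous ρ) : Continuous (layerCostG (n := n) ρ a) := by
  unfold layerCostG
  refine continuous_finsetSum _ fun y _ => continuous_finsetSum _ fun k _ =>
    continuous_finsetSum _ fun l _ => ?_
  by_cases h : k < l ∧ k ≠ a ∧ l ≠ a
  · simp only [dif_pos h]; exact (continuous_trRe ρ hρ).comp (continuous_hplaqG y h.2.1 h.2.2)
  · simp only [dif_neg h]; exact continuous_const

omit [IsTopologicalGroup G] [MeasurableSpace G] [BorelSpace G] [SecondCountableTopology G] in
/-- The in-layer cost is bounded. [folklore] -/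
theorem abs_layerCostG_le (hρ : Continuous ρ) (e : LEdge d (n + 1) a → G) :
    |layerCostG ρ a e| ≤ Fintype.card (LSite d (n + 1) a) * (Fintype.card (Fin d) *
      (Fintype.card (Fin d) * trReBound (G := G) (ρ := ρ) hρ)) := by
  have hs : ∀ {α : Type} [Fintype α] {f : α → ℝ} {C : ℝ}, (∀ x, |f x| ≤ C) →
      |∑ x, f x| ≤ Fintype.card α * C := fun h =>
    (Finset.abs_sum_le_sum_abs _ _).trans ((Finset.sum_le_sum fun x _ => h x).trans (by simp))
  unfold layerCostG
  refine hs fun y => hs fun k => hs fun l => ?_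
  by_cases h : k < l ∧ k ≠ a ∧ l ≠ a
  · rw [dif_pos h]; exact abs_trRe_le hρ _
  · rw [dif_neg h]; simpa using trReBound_nonneg hρ

/-- **The bounds** of the slab chain of `ρ`. [folklore] -/
theorem gChain_bounds (hρ : Continuous ρ) : (gChain ρ d n a).Bounds
    ((Fintype.card (LSite d (n + 1) a) : ℝ) * (Fintype.card (Fin d) *
      (Fintype.card (Fin d) * trReBound (G := G) (ρ := ρ) hρ)))
    (Fintype.card (LEdge d (n + 1) a) * trReBound (G := G) (ρ := ρ) hρ) where
  a_meas := fun _ => (continuous_layerCostG hρ).measurable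
  s_meas := fun _ => (continuous_slabCostG ρ hρ).measurable
  a_bound := fun _ e => abs_layerCostG_le hρ e
  s_bound := fun _ e w e' => abs_slabCostG_le ρ hρ e w e'
  Ma_nonneg := by have := trReBound_nonneg (G := G) (ρ := ρ) hρ; positivity
  Ms_nonneg := by have := trReBound_nonneg (G := G) (ρ := ρ) hρ; positivity

/-- The vertical moment constants of the slab chain of `ρ`: `momentConstG` below order four,
`c4G` at order four. [folklore] -/
def gMoment (ρ : G →* Matrix (Fin N) (Fin N) ℂ) (d n : ℕ) (a : Fin d) (_h : Fin (n + 1)) (m : ℕ) : ℂ :=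
  if m ≤ 3 then momentConstG ρ d (n + 1) a m else c4G ρ d (n + 1) a

/-- **The moment hypothesis of order four** for the slab chain of `ρ` (girth: `n + 1 ≥ 4`). [folklore] -/
theorem gChain_moments (h : OneLink ρ θ) (hn : 3 ≤ n) : (gChain ρ d n a).Moments
    (Measure.pi fun _ : LSite d (n + 1) a => haarProbability G) 4 (gMoment ρ d n a)
    (fun _ => rho4G ρ) where
  low := fun hh m hm e e' => by
    have hm3 : m ≤ 3 := by omega
    rw [gMoment, if_pos hm3]
    exact integral_slabCostG_pow_eq_const h (by omega) hm3 e e'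
  top := fun hh e e' => by
    rw [gMoment, if_neg (by omega)]
    exact integral_slabCostG_pow_four (ρ := ρ) e e'

/-! ## 2. Torus expectations are tilted ratios of the slab chain -/

omit [SecondCountableTopology G] in
/-- **The height reading of the torus Haar product is the product law of the chain.** [folklore] -/
theorem measurePreserving_heightCfgG_torusSigma (a : Fin d) :
    MeasurePreserving (fun U : ZdGaugeConfig d G => heightCfgG a (torusSigma (n + 1) U))
      (zdHaar d G)
      ((Measure.pi fun _ : Fin (n + 1) =>
          Measure.pi fun _ : LEdge d (n + 1) a => haarProbability G).prod
        (Measure.pi fun _ : Fin (n + 1) =>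
          Measure.pi fun _ : LSite d (n + 1) a => haarProbability G)) :=
  (measurePreserving_heightCfgG a).comp ⟨measurable_torusSigma (n + 1), map_torusSigma_zdHaar⟩

omit [SecondCountableTopology G] in
/-- The total cost of the genuine torus plaquettes, read by heights. [folklore] -/
theorem sum_torusCost_eq (h : OneLink ρ θ) (U : ZdGaugeConfig d G) :
    ∑ p ∈ torusGenuine d (n + 1), ((torusSystem ρ (n + 1)).cost p U : ℂ) =
      (N : ℂ) * ((torusGenuine d (n + 1)).card : ℂ) -
        ((gChain ρ d n a).cost (heightCfgG a (torusSigma (n + 1) U)) : ℂ) := by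
  rw [← sum_plaquetteTrRe_eq_cost ρ (trRe_inv h.trace_inv) (a := a) (torusSigma (n + 1) U)]
  simp only [torusSystem_cost, torusCost, trRe]
  push_cast
  rw [Finset.sum_sub_distrib, Finset.sum_const, nsmul_eq_mul, mul_comm]

/-- **`numZ = e^{-β N #V} · tilt`** for observables read by heights. [folklore] -/
theorem numZ_heightCfgG_eq (h : OneLink ρ θ) (Φ : HCfgG G d n a → ℂ) (hΦ : Measurable Φ) (β : ℂ) :
    (torusSystem ρ (n + 1)).numZ (fun U => Φ (heightCfgG a (torusSigma (n + 1) U)))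
        (torusGenuine d (n + 1)) β =
      Complex.exp (-(β * ((N : ℂ) * (torusGenuine d (n + 1)).card))) *
        tilt ((Measure.pi fun _ : Fin (n + 1) =>
            Measure.pi fun _ : LEdge d (n + 1) a => haarProbability G).prod
          (Measure.pi fun _ : Fin (n + 1) =>
            Measure.pi fun _ : LSite d (n + 1) a => haarProbability G))
          (gChain ρ d n a).cost Φ β := by
  rw [PlaqSystem.numZ_eq_integral_exp, tilt]
  simp_rw [sum_torusCost_eq h (a := a)]
  have hΘ := measurePreserving_heightCfgG_torusSigma (G := G) (d := d) (n := n) a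
  have hg : Measurable fun ω : HCfgG G d n a =>
      Complex.exp (-(β * ((N : ℂ) * (torusGenuine d (n + 1)).card))) *
        (Φ ω * Complex.exp (β * ((gChain ρ d n a).cost ω : ℂ))) :=
    measurable_const.mul (hΦ.mul (Complex.measurable_exp.comp (measurable_const.mul
      (Complex.measurable_ofReal.comp (SlabChain.measurable_cost (gChain_bounds h.cont))))))
  rw [← integral_const_mul, ← hΘ.map_eq, integral_map hΘ.measurable.aemeasurable hg.aestronglyMeasurable]
  refine integral_congr_ae (Eventually.of_forall fun U => ?_)
  beta_reduce
  rw [show -(β * ((N : ℂ) * ((torusGenuine d (n + 1)).card : ℂ) -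
      ((gChain ρ d n a).cost (heightCfgG a (torusSigma (n + 1) U)) : ℂ))) =
      -(β * ((N : ℂ) * (torusGenuine d (n + 1)).card)) +
        β * ((gChain ρ d n a).cost (heightCfgG a (torusSigma (n + 1) U)) : ℂ) by ring, Complex.exp_add]
  ring

/-- **Torus expectations of observables read by heights are tilted ratios of the chain.** [folklore] -/
theorem expect_heightCfgG_eq (h : OneLink ρ θ) (Φ : HCfgG G d n a → ℂ) (hΦ : Measurable Φ) (β : ℂ) :
    (torusSystem ρ (n + 1)).expect (fun U => Φ (heightCfgG a (torusSigma (n + 1) U)))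
        (torusGenuine d (n + 1)) β =
      tilt ((Measure.pi fun _ : Fin (n + 1) =>
            Measure.pi fun _ : LEdge d (n + 1) a => haarProbability G).prod
          (Measure.pi fun _ : Fin (n + 1) =>
            Measure.pi fun _ : LSite d (n + 1) a => haarProbability G))
          (gChain ρ d n a).cost Φ β /
        tilt ((Measure.pi fun _ : Fin (n + 1) =>
            Measure.pi fun _ : LEdge d (n + 1) a => haarProbability G).prod
          (Measure.pi fun _ : Fin (n + 1) =>
            Measure.pi fun _ : LSite d (n + 1) a => haarProbability G))
          (gChain ρ d n a).cost (fun _ => 1) β := by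
  have h1 : (torusSystem ρ (n + 1)).partZ (torusGenuine d (n + 1)) β = _ :=
    numZ_heightCfgG_eq h (a := a) (fun _ : HCfgG G d n a => (1 : ℂ)) measurable_const β
  rw [PlaqSystem.expect, h1, numZ_heightCfgG_eq h Φ hΦ, mul_div_mul_left _ _ (Complex.exp_ne_zero _)]

/-! ## 3. The plaquette observables of the crux are layer plaquettes -/

omit [TopologicalSpace G] [IsTopologicalGroup G] [CompactSpace G] [MeasurableSpace G] [BorelSpace G]
  [SecondCountableTopology G] in
/-- The axis-site plaquette is the layer plaquette `holG`. [folklore] -/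
theorem plaquetteHolonomy_axisSite_eq_holG (hi : i ≠ a) (hj : j ≠ a)
    (W : GaugeConfig d (n + 1) G) (τ : Fin (n + 1)) :
    plaquetteHolonomy W (Function.update (0 : Site d (n + 1)) a (-(Lattice.U1Layer.toZ τ))) i j =
      holG hi hj (layerCfgG a W τ) :=
  plaquetteHolonomy_axisSite_eq hi hj W τ

omit [TopologicalSpace G] [IsTopologicalGroup G] [CompactSpace G] [MeasurableSpace G] [BorelSpace G]
  [SecondCountableTopology G] in
/-- **The periodised plaquette at the origin is the layer observable at height `0`.** [folklore] -/
theorem plaquetteObs_torusRed_eq_xObsG (hi : i ≠ a) (hj : j ≠ a) (U : ZdGaugeConfig d G) :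
    plaquetteObs ρ 0 i j (U ∘ torusRed (n + 1)) =
      xObsG ρ hi hj (layerCfgG a (torusSigma (n + 1) U) 0) := by
  have h1 : plaquetteObs ρ 0 i j (U ∘ torusRed (n + 1)) =
      toTorusObservable (n + 1) (plaquetteObs ρ 0 i j) (torusSigma (n + 1) U) := rfl
  rw [h1, toTorusObservable_plaquetteObs]
  dsimp only
  have h0 : (Torus.proj (n + 1) (0 : Literature.Probability.LatticeModels.Site d) : Site d (n + 1)) =
      Function.update (0 : Site d (n + 1)) a (-(Lattice.U1Layer.toZ (0 : Fin (n + 1)))) := by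
    rw [Lattice.U1Layer.toZ_zero, neg_zero,
      (Function.update_eq_self_iff (f := (0 : Site d (n + 1))) (a := a) (b := 0)).2 rfl]
    funext k
    simp [Torus.proj_apply]
  rw [h0, plaquetteHolonomy_axisSite_eq_holG hi hj, xObsG, trRe]

omit [TopologicalSpace G] [IsTopologicalGroup G] [CompactSpace G] [BorelSpace G]
  [SecondCountableTopology G] in
/-- **The periodised plaquette translated by `t·e_a` is the layer observable at height `t`.** [folklore] -/
theorem plaquetteObs_configShift_torusRed_eq_xObsG (hi : i ≠ a) (hj : j ≠ a)
    (U : ZdGaugeConfig d G) (τ : Fin (n + 1)) :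
    plaquetteObs ρ 0 i j (configShift (Pi.single a (τ.val : ℤ)) (U ∘ torusRed (n + 1))) =
      xObsG ρ hi hj (layerCfgG a (torusSigma (n + 1) U) τ) := by
  have h1 : plaquetteObs ρ 0 i j (configShift (Pi.single a (τ.val : ℤ)) (U ∘ torusRed (n + 1))) =
      toTorusObservable (n + 1) (plaquetteObs ρ 0 i j ∘ configShift (Pi.single a (τ.val : ℤ)))
        (torusSigma (n + 1) U) := rfl
  rw [h1, toTorusObservable_plaquetteObs_comp_configShift]
  dsimp only
  rw [zero_sub, torusProj_neg_single_natCast,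
    show -Pi.single a ((τ.val : ℕ) : ZMod (n + 1)) =
      Function.update (0 : Site d (n + 1)) a (-(Lattice.U1Layer.toZ τ))
      from (update_zero_eq_neg_single τ).symm, plaquetteHolonomy_axisSite_eq_holG hi hj, xObsG, trRe]

/-- The layer observable `ω ↦ xObsG(η_h)` (complex-valued). [folklore] -/
def obsXG (ρ : G →* Matrix (Fin N) (Fin N) ℂ) (hi : i ≠ a) (hj : j ≠ a) (h : Fin (n + 1))
    (ω : HCfgG G d n a) : ℂ :=
  ((xObsG ρ hi hj (ω.1 h) : ℝ) : ℂ)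

/-- The product observable `ω ↦ xObsG(η_h) xObsG(η_h')` (complex-valued). [folklore] -/
def obsXYG (ρ : G →* Matrix (Fin N) (Fin N) ℂ) (hi : i ≠ a) (hj : j ≠ a) (h h' : Fin (n + 1))
    (ω : HCfgG G d n a) : ℂ :=
  ((xObsG ρ hi hj (ω.1 h) * xObsG ρ hi hj (ω.1 h') : ℝ) : ℂ)

omit [CompactSpace G] in
/-- `obsXG` is measurable. [folklore] -/
theorem measurable_obsXG (hρ : Continuous ρ) (hi : i ≠ a) (hj : j ≠ a) (h : Fin (n + 1)) :
    Measurable (obsXG (d := d) (n := n) ρ hi hj h) :=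
  Complex.measurable_ofReal.comp ((continuous_xObsG ρ hi hj hρ).measurable.comp
    ((measurable_pi_apply h).comp measurable_fst))

omit [CompactSpace G] in
/-- `obsXYG` is measurable. [folklore] -/
theorem measurable_obsXYG (hρ : Continuous ρ) (hi : i ≠ a) (hj : j ≠ a) (h h' : Fin (n + 1)) :
    Measurable (obsXYG (d := d) (n := n) ρ hi hj h h') :=
  Complex.measurable_ofReal.comp ((((continuous_xObsG ρ hi hj hρ).measurable.comp
    ((measurable_pi_apply h).comp measurable_fst))).mul ((continuous_xObsG ρ hi hj hρ).measurable.comp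
    ((measurable_pi_apply h').comp measurable_fst)))

/-! ## 4. (LC) at every separation and (U′) for every `R`, for `(G, ρ)` -/

/-- **(LC) AT EVERY SEPARATION FOR A GENERAL GAUGE GROUP.**  For a compact second countable
group `G` and a representation `ρ` with one-link data `OneLink ρ θ`, on the torus plaquette system
of side `L + 1`, `L ≥ 3`, `L ≥ 2t`, in any dimension, directions `i < j`, `a ∉ {i, j}`, separation
`t ≥ 1`, with `P` the periodised plaquette observable `Re tr ρ(U_p)` at the origin in the `(i, j)`
plane: `torusTruncC ρ (L+1) P P (t·e_a) β − N θ^{4t+1} β^{4t} = O(β^{4t+1})` at `β = 0`. [folklore] -/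
theorem torusTruncC_leadingCoeff (h : OneLink ρ θ) (hij : i < j) (hai : a ≠ i) (haj : a ≠ j)
    {t : ℕ} (ht : 1 ≤ t) (L : ℕ) (hL3 : 3 ≤ L) (hLt : 2 * t ≤ L) :
    (fun β : ℂ => torusTruncC ρ (L + 1) (plaquetteObs ρ 0 i j) (plaquetteObs ρ 0 i j)
        (Pi.single a (t : ℤ)) β - (((N : ℝ) * θ ^ (4 * t + 1) : ℝ) : ℂ) * β ^ (4 * t))
      =O[𝓝 (0 : ℂ)] fun β => β ^ (4 * t + 1) := by
  have hi : i ≠ a := fun h => hai h.symm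
  have hj : j ≠ a := fun h => haj h.symm
  have hij' : i ≠ j := hij.ne
  have hρ := h.cont
  set τ : Fin (L + 1) := ⟨t, by omega⟩ with hτdef
  have hτv : τ.val = t := rfl
  -- the slab-chain theorem for the chain of `ρ`
  have key := SlabChain.cov_tilt_jetEq
    (Measure.pi fun _ : LEdge d (L + 1) a => haarProbability G)
    (Measure.pi fun _ : LSite d (L + 1) a => haarProbability G)
    (gChain_bounds (d := d) (n := L) (a := a) hρ) (gChain_moments h (by omega)) (by norm_num)
    (fun _ => measurable_rho4G hρ) (fun _ e e' => norm_rho4G_le hρ e e')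
    (fun _ e' => integral_rho4G_left hρ e') (fun _ e => integral_rho4G_right hρ e)
    (continuous_xObsG ρ hi hj hρ).measurable (continuous_xObsG ρ hi hj hρ).measurable
    (abs_xObsG_le ρ hi hj hρ) (abs_xObsG_le ρ hi hj hρ) (τ := τ) (by omega) (by omega)
  -- the leading coefficient by the eigenvalue relation
  rw [SlabChain.integral_chain_eigen_const (Measure.pi fun _ : LEdge d (L + 1) a => haarProbability G)
    (fun _ => measurable_rho4G hρ) (fun _ e e' => norm_rho4G_le hρ e e')
    (continuous_xObsG ρ hi hj hρ).measurable (continuous_xObsG ρ hi hj hρ).measurable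
    (abs_xObsG_le ρ hi hj hρ) (abs_xObsG_le ρ hi hj hρ)
    (fun _ e' => integral_xObsG_mul_rho4G hi hj hij' h (by omega) e') τ,
    integral_xObsG_sq hi hj hij' h (by omega)] at key
  -- the three torus expectations are tilted ratios of the chain
  have fX : (fun U : ZdGaugeConfig d G =>
      ((plaquetteObs ρ 0 i j (U ∘ torusRed (L + 1)) : ℝ) : ℂ)) =
      fun U => obsXG ρ hi hj 0 (heightCfgG a (torusSigma (L + 1) U)) := by
    funext U
    show _ = ((xObsG ρ hi hj (layerCfgG a (torusSigma (L + 1) U) 0) : ℝ) : ℂ)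
    rw [plaquetteObs_torusRed_eq_xObsG hi hj U]
  have fY : (fun U : ZdGaugeConfig d G =>
      ((plaquetteObs ρ 0 i j (configShift (Pi.single a (t : ℤ)) (U ∘ torusRed (L + 1))) : ℝ) : ℂ)) =
      fun U => obsXG ρ hi hj τ (heightCfgG a (torusSigma (L + 1) U)) := by
    funext U
    show _ = ((xObsG ρ hi hj (layerCfgG a (torusSigma (L + 1) U) τ) : ℝ) : ℂ)
    rw [← plaquetteObs_configShift_torusRed_eq_xObsG hi hj U τ]
  have fXY : (fun U : ZdGaugeConfig d G =>
      ((plaquetteObs ρ 0 i j (U ∘ torusRed (L + 1)) : ℝ) : ℂ) *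
        ((plaquetteObs ρ 0 i j (configShift (Pi.single a (t : ℤ)) (U ∘ torusRed (L + 1))) : ℝ) : ℂ)) =
      fun U => obsXYG ρ hi hj 0 τ (heightCfgG a (torusSigma (L + 1) U)) := by
    funext U
    show _ = ((xObsG ρ hi hj (layerCfgG a (torusSigma (L + 1) U) 0) *
      xObsG ρ hi hj (layerCfgG a (torusSigma (L + 1) U) τ) : ℝ) : ℂ)
    rw [plaquetteObs_torusRed_eq_xObsG hi hj U, ← plaquetteObs_configShift_torusRed_eq_xObsG hi hj U τ]
    push_cast
    rfl
  set νΩ := (Measure.pi fun _ : Fin (L + 1) =>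
      Measure.pi fun _ : LEdge d (L + 1) a => haarProbability G).prod
    (Measure.pi fun _ : Fin (L + 1) => Measure.pi fun _ : LSite d (L + 1) a => haarProbability G)
    with hνΩ
  have eT : ∀ β : ℂ, torusTruncC ρ (L + 1) (plaquetteObs ρ 0 i j) (plaquetteObs ρ 0 i j)
      (Pi.single a (t : ℤ)) β =
      tilt νΩ (gChain ρ d L a).cost (obsXYG ρ hi hj 0 τ) β / tilt νΩ (gChain ρ d L a).cost (fun _ => 1) β -
      tilt νΩ (gChain ρ d L a).cost (obsXG ρ hi hj 0) β / tilt νΩ (gChain ρ d L a).cost (fun _ => 1) β *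
      (tilt νΩ (gChain ρ d L a).cost (obsXG ρ hi hj τ) β /
        tilt νΩ (gChain ρ d L a).cost (fun _ => 1) β) := fun β => by
    rw [torusTruncC, fXY, fX, fY, expect_heightCfgG_eq h _ (measurable_obsXYG hρ hi hj 0 τ),
      expect_heightCfgG_eq h _ (measurable_obsXG hρ hi hj 0),
      expect_heightCfgG_eq h _ (measurable_obsXG hρ hi hj τ)]
  -- the leading coefficient `(θ⁴)^t · Nθ = N θ^{4t+1}`
  have hb : ((θ : ℂ) ^ 4) ^ τ.val * ((N : ℂ) * θ) = (((N : ℝ) * θ ^ (4 * t + 1) : ℝ) : ℂ) := by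
    rw [hτv]
    push_cast
    ring
  unfold JetEq at key
  refine key.congr_left fun β => ?_
  rw [eT β, hb]
  rfl

/-- **(U′) AT STRONG COUPLING FOR A GENERAL GAUGE GROUP, EVERY `R`.**  For a compact second
countable group `G`, a representation `ρ : G →* M_N(ℂ)`, `N ≥ 1`, with one-link data
`OneLink ρ θ`, directions `i < j`, `a ∉ {i, j}`, and every `R`: there is `β₀ > 0` such that for
every real `β ≠ 0` with `|β| ≤ β₀` the venture's cross-cut correlator floor
`Conjectures.CrossCutCorrelatorFloor d N G ρ β R i j a` holds. [folklore] -/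
theorem crossCutCorrelatorFloor_of_oneLink [NeZero N] (h : OneLink ρ θ) (hij : i < j)
    (hai : a ≠ i) (haj : a ≠ j) (R : ℕ) :
    ∃ β₀ : ℝ, 0 < β₀ ∧ ∀ β : ℝ, β ≠ 0 → |β| ≤ β₀ →
      Conjectures.CrossCutCorrelatorFloor d N G ρ β R i j a := by
  have hb : (N : ℝ) * θ ^ (4 * (2 * R + 1) + 1) ≠ 0 :=
    mul_ne_zero (Nat.cast_ne_zero.2 (NeZero.ne N)) (pow_ne_zero _ (theta_pos h).ne')
  exact crossCutCorrelatorFloor_of_leadingCoeff ρ h.cont i j a R (n := 4 * (2 * R + 1)) hb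
    (max 3 (2 * (2 * R + 1)))
    fun L hL => torusTruncC_leadingCoeff h hij hai haj (t := 2 * R + 1) (by omega) L
      (le_of_max_le_left hL) (le_of_max_le_right hL)

/-- **The repaired item (U′-R) at strong coupling for a general gauge group, every `R`.** [folklore] -/
theorem crossCutCorrelatorFloorR_of_oneLink [NeZero N] (h : OneLink ρ θ) (hij : i < j)
    (hai : a ≠ i) (haj : a ≠ j) (R : ℕ) :
    ∃ β₀ : ℝ, 0 < β₀ ∧ ∀ β : ℝ, β ≠ 0 → |β| ≤ β₀ →
      Conjectures.CrossCutCorrelatorFloorR d N G ρ β R i j a := by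
  have hb : (N : ℝ) * θ ^ (4 * (2 * R + 1) + 1) ≠ 0 :=
    mul_ne_zero (Nat.cast_ne_zero.2 (NeZero.ne N)) (pow_ne_zero _ (theta_pos h).ne')
  exact crossCutCorrelatorFloorR_of_leadingCoeff ρ h.cont i j a R (n := 4 * (2 * R + 1)) hb
    (max 3 (2 * (2 * R + 1)))
    fun L hL => torusTruncC_leadingCoeff h hij hai haj (t := 2 * R + 1) (by omega) L
      (le_of_max_le_left hL) (le_of_max_le_right hL)

end Summit.Ventures.LatticeQCDFlow.Theory2.GroupLayer

end
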